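import Summits.RiemannHypothesis.RiemannHypothesis.Theorems.GroundBartaPolarPerronFrobeniusGroundCriterion
import Summits.RiemannHypothesis.RiemannHypothesis.Theorems.GroundBartaPolarPerronFrobeniusEvenRealGroundState
import HarnessLib
import Summits.RiemannHypothesis.RiemannHypothesis.Theses.GroundBarta

/-!
# RiemannHypothesis / GroundBarta — crux `PolarPerronFrobenius` (stmt-RiemannHypothesis-18390):
# the ground-state source criterion, part G3: COFINAL SOURCE-POSITIVE GROUND STATES ⇒ THE CRUX

Helper file (`--supports stmt-RiemannHypothesis-18390`), RH-free, Mathlib + proved tree files only,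
no definitions, no named facts.

Part G2 (`…GroundCriterion.lean`): a real measurable ground state `u` at the window `a` whose source
`S_u(y) = ∫_{(0,∞)} w(t)(u⁺(y+t)+u⁺(y−t)) dt + Σ_{log n<2a} Λ(n)n^{-1/2}(u⁺(y+log n)+u⁺(y−log n))
− 2∫ u⁺(x)cosh((x−y)/2) dx` is positive a.e. on `{u < 0}` is `≥ 0` a.e.  Here:

* `swg_GSPinline_of_source_pos`: the same conclusion in the route items' inline encoding of `GSP a`;
* `polarPerronFrobenius_of_cofinal_groundSourcePos`: **if beyond every height there is a window at
  which (granted the even sector carries the bottom there) some real measurable ground state has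
  positive source on its negative set, then `PolarPerronFrobenius` holds.**

This is the u-level, Euler–Lagrange-free form of the harmonic-majorant line
(`Cruxes/PolarPerronFrobenius/Ideas/harmonic-majorant-edge-source.md`): its RH-strength input
(`SharpBulkShape`: the even ground state is `Φ`-shaped on the bulk, so that `{u<0}` lies in the thin
edge layer where the capacity term makes `S_u > 0`) now feeds a landed theorem directly.

Prover B, speedrun unit `sr-gb-rung-b` (seat 2).
-/

set_option linter.dupNamespace false

noncomputable section

open Set MeasureTheory Filter Complex
open scoped Real Topology

namespace Summit.RiemannHypothesis.RiemannHypothesis.Theorems.PolarPerronFrobenius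

open Literature.NumberTheory.LFunctions
open scoped ArithmeticFunction.vonMangoldt

/-- **`GSP a` (route inline encoding) from a source-positive real ground state.** [folklore] -/
theorem swg_GSPinline_of_source_pos {a : ℝ} (ha : 0 < a) {u : ℝ → ℝ} (hum : Measurable u)
    (hU : IsWeilGroundState a (fun x ↦ ((u x : ℝ) : ℂ)))
    (hsrc : ∀ᵐ y : ℝ, u y < 0 → 0 <
      (∫ t in Ioi (0 : ℝ), weilArchDensity t * (max (u (y + t)) 0 + max (u (y - t)) 0)) +
      (∑ n ∈ weilPrimeIndex a, (Λ n : ℝ) / Real.sqrt n *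
        (max (u (y + Real.log n)) 0 + max (u (y - Real.log n)) 0)) -
      2 * ∫ x, max (u x) 0 * Real.cosh ((x - y) / 2)) :
    ∃ v : ℝ → ℂ, (MemLp v 2 ∧ ∃ g : ℕ → ℝ → ℂ,
      (∀ n, IsWeilTest (g n) ∧ tsupport (g n) ⊆ Icc (-a) a ∧ ∫ t, ‖g n t‖ ^ 2 = (1 : ℝ)) ∧
      (∀ h : ℝ → ℂ, IsWeilTest h → tsupport h ⊆ Icc (-a) a → ∫ t, ‖h t‖ ^ 2 = (1 : ℝ) →
        ∀ δ : ℝ, 0 < δ → ∀ᶠ n in atTop, (weilQuadratic (g n)).re ≤ (weilQuadratic h).re + δ) ∧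
      Tendsto (fun n ↦ ∫ t, ‖g n t - v t‖ ^ 2) atTop (𝓝 0)) ∧
      (∀ᵐ t : ℝ, t ∈ Ioo (-a) a → (v t).im = 0 ∧ 0 ≤ (v t).re) := by
  obtain ⟨v, hv, hsign⟩ := swg_GSP_of_source_pos ha hum hU hsrc
  exact ⟨v, (isWeilGroundState_iff_forall_eventually_le a v).1 hv, hsign.mono fun t ht _ ↦ ht⟩

/-- **The crux from cofinally source-positive ground states.**  If beyond every height `A` there is a
window `a ≥ A` at which — granted that the even sector carries the bottom at `a` (`EW a`) — some real
measurable ground state `u` of the full windowed Weil form has positive source a.e. on `{u < 0}`,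
then `PolarPerronFrobenius` holds (indeed `GSP a` there, by `swg_GSP_of_source_pos`). [folklore] -/
theorem polarPerronFrobenius_of_cofinal_groundSourcePos
    (hyp : ∀ A : ℝ, ∃ a : ℝ, A ≤ a ∧ 0 < a ∧
      ((∀ o : ℝ → ℂ, IsWeilTest o → tsupport o ⊆ Set.Icc (-a) a →
            (∀ t, o (-t) = -o t) → ∫ t, ‖o t‖ ^ 2 = (1 : ℝ) → ∀ δ : ℝ, 0 < δ →
              ∃ w : ℝ → ℂ, IsWeilTest w ∧ tsupport w ⊆ Set.Icc (-a) a ∧ (∀ t, w (-t) = w t) ∧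
                ∫ t, ‖w t‖ ^ 2 = (1 : ℝ) ∧ (weilQuadratic w).re ≤ (weilQuadratic o).re + δ) →
        ∃ u : ℝ → ℝ, Measurable u ∧ IsWeilGroundState a (fun x ↦ ((u x : ℝ) : ℂ)) ∧
          (∀ᵐ y : ℝ, u y < 0 → 0 <
            (∫ t in Ioi (0 : ℝ), weilArchDensity t * (max (u (y + t)) 0 + max (u (y - t)) 0)) +
            (∑ n ∈ weilPrimeIndex a, (Λ n : ℝ) / Real.sqrt n *
              (max (u (y + Real.log n)) 0 + max (u (y - Real.log n)) 0)) -
            2 * ∫ x, max (u x) 0 * Real.cosh ((x - y) / 2)))) :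
    Summit.RiemannHypothesis.RiemannHypothesis.Theses.GroundBarta.PolarPerronFrobenius := by
  rw [show Summit.RiemannHypothesis.RiemannHypothesis.Theses.GroundBarta.PolarPerronFrobenius ↔
      ∀ A : ℝ, ∃ a : ℝ, A ≤ a ∧
        ((∀ o : ℝ → ℂ, IsWeilTest o → tsupport o ⊆ Icc (-a) a → (∀ t, o (-t) = -o t) →
            ∫ t, ‖o t‖ ^ 2 = (1 : ℝ) → ∀ δ : ℝ, 0 < δ → ∃ w : ℝ → ℂ, IsWeilTest w ∧
              tsupport w ⊆ Icc (-a) a ∧ (∀ t, w (-t) = w t) ∧ ∫ t, ‖w t‖ ^ 2 = (1 : ℝ) ∧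
              (weilQuadratic w).re ≤ (weilQuadratic o).re + δ) →
          ∃ u : ℝ → ℂ, (MemLp u 2 ∧ ∃ g : ℕ → ℝ → ℂ,
            (∀ n, IsWeilTest (g n) ∧ tsupport (g n) ⊆ Icc (-a) a ∧ ∫ t, ‖g n t‖ ^ 2 = (1 : ℝ)) ∧
            (∀ h : ℝ → ℂ, IsWeilTest h → tsupport h ⊆ Icc (-a) a → ∫ t, ‖h t‖ ^ 2 = (1 : ℝ) →
              ∀ δ : ℝ, 0 < δ → ∀ᶠ n in atTop, (weilQuadratic (g n)).re ≤ (weilQuadratic h).re + δ) ∧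
            Tendsto (fun n => ∫ t, ‖g n t - u t‖ ^ 2) atTop (nhds 0)) ∧
          (∀ᵐ t : ℝ, t ∈ Ioo (-a) a → (u t).im = 0 ∧ 0 ≤ (u t).re)) from Iff.rfl]
  intro A
  obtain ⟨a, ha, ha0, hH⟩ := hyp A
  refine ⟨a, ha, fun hEW ↦ ?_⟩
  obtain ⟨u, hum, hU, hsrc⟩ := hH hEW
  exact swg_GSPinline_of_source_pos ha0 hum hU hsrc

end Summit.RiemannHypothesis.RiemannHypothesis.Theorems.PolarPerronFrobenius

end
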